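import Literature.Analysis.FluidPDE.AxisymNoSwirlScaleInvariantBounds
import Literature.Analysis.FluidPDE.BiotSavartBounds
import Literature.Analysis.FluidPDE.MeridianReduction
import HarnessLib

/-!
# The axisymmetric Biot–Savart sup bounds `‖u‖_∞ ≤ C ‖rω_θ‖_{L¹(Ω)}^{1/2} ‖ω_θ/r‖_{L^∞}^{1/2}`
# (Feng–Šverák 2015 / Gallay–Šverák 2015, Prop. 2.6 (2.14)) and
# `‖u‖_∞ ≤ C ‖ω_θ‖_{L¹(Ω)}^{1/2} ‖ω_θ‖_{L^∞}^{1/2}` (Gallay–Šverák 2015, Prop. 2.3 (ii) (2.10)) —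
# proved, with `C` explicit; discharge of the named fact `GallaySverak2015.VelocitySupBound`

Analysis/FluidPDE proof file (theorems only; no definitions, no named facts). It DISCHARGES the
named fact `Literature.Analysis.FluidPDE.GallaySverak2015.VelocitySupBound`
(`AxisymNoSwirlScaleInvariantBounds.lean`; Th. Gallay, V. Šverák, *Remarks on the Cauchy problem
for the axisymmetric Navier–Stokes equations*, Confluentes Math. 7 (2015) 67–92 =
arXiv:1510.01036, Prop. 2.6, estimate (2.14), p. 8: "`‖u‖_{L^∞(Ω)} ≤ C ‖rω_θ‖_{L¹(Ω)}^{1/2}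
‖ω_θ/r‖_{L^∞(Ω)}^{1/2}`", after H. Feng, V. Šverák, ARMA 215 (2015)) by an elementary
three-dimensional argument which gives the constant explicitly:

* `norm_biotSavart_le_sqrt_of_norm_le_mul_cylRadius` — for a continuous integrable vector field
  `w` on `ℝ³` whose norm is invariant under the rotations about the axis (`‖w(R_θ y)‖ = ‖w(y)‖`;
  every axisymmetric field) with `‖w(y)‖ ≤ M r(y)` (`r = cylRadius`), the Biot–Savart velocity
  `K₃ ∗ w = biotSavart w` (Majda–Bertozzi (2.10)–(2.12), `Vorticity.lean`) satisfies, for all `x`,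
  `‖(K₃ ∗ w)(x)‖ ≤ 3 √(M ∫_{ℝ³}‖w‖)`; in the units of the paper (`∫_{ℝ³}‖ω‖ dx = 2π‖rω_θ‖_{L¹(Ω)}`,
  `M = ‖ω_θ/r‖_{L^∞}`) this is (2.14) with `C = 3√(2π)`;
* `GallaySverak2015.VelocitySupBound_holds` — the fact as typed (`∃ C ≥ 0, …`), with `C = 3`
  (its toroidality hypotheses `x₀ω₀ + x₁ω₁ = 0`, `ω₂ = 0` are not needed for the bound);
* `norm_biotSavart_le_sqrt_of_norm_le` (and `…_of_isAxisymmetric_of_norm_le`) — the SUP-NORM FORM,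
  Gallay–Šverák Prop. 2.3 (ii), estimate (2.10) in the case `p = 1`, `q = ∞` (p. 7:
  "`‖u‖_{L^∞(Ω)} ≤ C‖ω_θ‖_{L^p(Ω)}^σ‖ω_θ‖_{L^q(Ω)}^{1−σ}`", `σ = 1/2`), the kinematic half of the
  paper's (5.12): for `w` continuous with rotation-invariant norm, `‖w‖ ≤ L` and `‖w‖/r ∈ L¹(ℝ³)`
  (no integrability of `w` itself is needed), `‖(K₃ ∗ w)(x)‖ ≤ (11/10) √(L ∫_{ℝ³}‖w‖/r)`; in the
  paper's units (`∫_{ℝ³}‖ω‖/r dx = 2π‖ω_θ‖_{L¹(Ω)}`, `L = ‖ω_θ‖_{L^∞}`) this is (2.10) with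
  `C = (11/10)√(2π)`. Same proof as below with the near field bounded by `L · 4πρ` and the far field
  averaged against the weight `‖w‖/r` (orbit integrals of `r(y) 1_{|x−y|≥ρ}|x−y|⁻²` are `≤ 20/ρ`,
  `lintegral_orbit_far_kernel_mul_cylRadius_le`; the axis is null, `volume_axis_eq_zero`), giving
  `‖(K₃ ∗ w)(x)‖ ≤ Lρ + (5/(2π²))ρ⁻¹∫‖w‖/r` for every `ρ > 0`, optimised (`2√(5/(2π²)) = √10/π ≤ 11/10`).

## The proof (not the paper's, which goes through the axisymmetric Biot–Savart kernel (2.11))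

`‖K₃(x − y) w(y)‖ ≤ (4π)⁻¹ ‖w(y)‖ |x − y|⁻²` (`norm_biotSavartKernel_le`, `BiotSavartBounds`), so
`‖(K₃ ∗ w)(x)‖ ≤ (4π)⁻¹ ∫ ‖w(y)‖ |x−y|⁻² dy`, and the kernel is split at a scale `ρ > 0`
(`enorm_biotSavart_le_near_add_far`):

* NEAR FIELD `|x − y| < ρ` (`lintegral_enorm_mul_kernelMajorant_le`): there `r(y) ≤ r(x) + ρ`, so
  `‖w(y)‖ ≤ M (r(x) + ρ)` and `∫_{|z|<ρ} |z|⁻² dz = 4πρ` (`lintegral_kernelMajorant`) give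
  `≤ M (r(x)+ρ) 4πρ`;
* FAR FIELD `|x − y| ≥ ρ`, trivially `≤ ρ⁻² ∫‖w‖` (`lintegral_enorm_mul_far_kernel_le_inv_sq`), and —
  the axisymmetric input — for `r(x) ≥ 2ρ`, `≤ (10/(πρ r(x))) ∫‖w‖`
  (`lintegral_enorm_mul_far_kernel_le`): by ROTATION AVERAGING (`‖w‖` is invariant and `y ↦ R_φ y`
  preserves Lebesgue measure, Tonelli; `ofReal_two_pi_mul_lintegral_mul_eq`)
  `2π ∫ ‖w‖ G = ∫ ‖w(y)‖ (∫_{−π}^{π} G(R_φ y) dφ) dy` for `G(y) = 1_{|x−y|≥ρ}|x − y|⁻²`, and along every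
  orbit, in meridian coordinates `x = R_α(r,0,z)`, `y = R_β(r',0,z')` (`rotZ_arg_meridianPoint`),
  `|x − R_φ y|² = q(φ + β − α)`, `q(ψ) = (r−r')² + (z−z')² + 2rr'(1 − cos ψ)`
  (`norm_sub_rotZ_eq_meridian`, `norm_meridianPoint_sub_rotZ_meridianPoint_sq`), so that the orbit
  integral is `∫_{−π}^{π} 1_{q≥ρ²} q⁻¹ dψ ≤ 20/(ρ r)` (`intervalIntegral_far_kernel_le`: if
  `r' ≤ r/4` then `q ≥ (3r/4)²`; otherwise Jordan's inequality `1 − cos ψ ≥ 2ψ²/π²`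
  (`two_mul_sq_div_pi_sq_le_one_sub_cos`) gives `q ≥ max(ρ², (4rr'/π²)ψ²)`, and
  `∫_{−π}^{π} dψ/(a² + b²ψ²) ≤ π/(ab)` (`intervalIntegral_inv_sq_add_sq_mul_sq_le`, arctangent) with
  `√(rr') ≥ r/2`).

With `A = ∫‖w‖`, `s = √(A/M)`: for `r(x) ≤ √s` take `ρ = √s` (bound `(2 + 1/(4π))√(AM)`), otherwise
`ρ = s/(2r(x))` (bound `(3/4 + 5/π²)√(AM)`); both `≤ 3√(AM)`. The degenerate case `w = 0` is
separate (`biotSavart_zero`).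

What is NOT here: the companion bound (2.15) `‖u_r/r‖_∞ ≤ C‖ω_θ‖_{L¹}^{1/3}‖ω_θ/r‖_∞^{2/3}`, the
axisymmetric Biot–Savart kernel estimates (2.11), the general `L^p–L^q` cases of Prop. 2.3 and
Prop. 2.4 of the paper; the named facts Prop. 5.3 (`VorticitySupBound`) and (1.12)
(`VelocitySupDecay`) of `AxisymNoSwirlScaleInvariantBounds` stay facts (the sup-norm form proved
here is the kinematic step (5.12) from the former to the latter; the dynamic step needs, besides
Prop. 5.3, the Biot–Savart representation of Tao-class slices whose vorticity is only known to
have `ω/r ∈ L¹`, not `ω ∈ L¹(ℝ³)` — not in the tree). Consequence for consumers: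
`speedCap_of_facts VelocitySupBound_holds ImpulseConservation_holds` (the latter from
`AxisymNoSwirlImpulseConservation`) is the unconditional all-time speed cap (`AxisymNoSwirlSpeedCap`).

## Mathlib / tree search

Tree (used): `biotSavart`, `biotSavartKernel`, `biotSavart_zero` (`Vorticity`);
`norm_biotSavartKernel_le`, `kernelMajorant`, `measurable_kernelMajorant`,
`lintegral_kernelMajorant` (`BiotSavartBounds`, Majda–Bertozzi Lemma 4.5 infrastructure); `rotZ`,
`rotZ_add`, `norm_rotZ`, `IsAxisymmetric`, `cylRadius`, `cylRadius_sq` (`AxisymmetricEuler`);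
`rotZLIE` and its `measurePreserving` (`AxisymmetricVorticityTransport`; cf.
`measurePreserving_rotZ` of `KNSSAxisymmetricNoSwirl`, not imported); `meridian`, `meridianPoint`,
`rotZ_arg_meridianPoint` (`MeridianReduction`). `lean search 'biotSavart.*sqrt|VelocitySupBound_holds|
angular.*far|orbit.*kernel'`: nothing before this file; the tree's angular means
(`PineauVicolAngularMean`, continuous integrands, Bochner) and `CylindricalIntegration` (radial
reduction of axisymmetric integrands) do not cover the non-axisymmetric, discontinuous kernel
`1_{|x−y|≥ρ}|x−y|⁻²`; the small lemmas `rotZ_sub`, `continuous_rotZ_uncurry`, `abs_cylRadius_sub_le`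
exist in heavier files (`GavrilovLocalisation`, `KNSSTypeIRateLimit`,
`PeriodicCylinderNeumannWallSmooth`) and are re-proved privately to keep the imports light; also
used: `volume_axis_eq_zero` (`AxisymWeights`), `cylRadius_rotZ`, `continuous_cylRadius`
(`AxisymmetricEuler`). `lean search 'norm_biotSavart_le|sup.*omega_theta|2.10'` (2026-08-26): no
sup-norm form of the axisymmetric Biot–Savart bound before this file. Mathlib: `enorm_integral_le_lintegral_enorm`, `MeasurePreserving.lintegral_comp_emb`,
`lintegral_lintegral_swap`, `ofReal_integral_eq_lintegral_ofReal`,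
`Function.Periodic.intervalIntegral_add_eq`, `intervalIntegral.integral_comp_add_right`,
`intervalIntegral.integral_comp_mul_left`, `integral_inv_one_add_sq`, `Real.arctan_lt_pi_div_two`,
`Real.mul_le_sin` (Jordan), `integral_pos_iff_support_of_nonneg`, `IsOpen.measure_pos`.

## References

* Th. Gallay, V. Šverák, *Remarks on the Cauchy problem for the axisymmetric Navier–Stokes
  equations*, Confluentes Math. 7 (2015) 67–92 = arXiv:1510.01036, Prop. 2.3 (ii) (2.10), p. 7;
  Prop. 2.6 (2.14), p. 8; (5.12), p. 17. [GallaySverak2016]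
* H. Feng, V. Šverák, *On the Cauchy problem for axi-symmetric vortex rings*, Arch. Ration.
  Mech. Anal. 215 (2015) 89–123 (the original form of (2.14)).
* A. J. Majda, A. L. Bertozzi, *Vorticity and Incompressible Flow*, CUP 2002, (2.10)–(2.12) and
  Lemma 4.5. [MajdaBertozziCUP2002]
-/

noncomputable section

open MeasureTheory Set Function Filter Metric Real
open _root_.Topology
open scoped ENNReal NNReal

namespace Literature.Analysis.FluidPDE

/-! ### Elementary geometry of the rotations about the axis -/

section Geometry

/-- `R_θ (x − y) = R_θ x − R_θ y`. [folklore] -/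
private theorem rotZ_sub' (θ : ℝ) (x y : EuclideanSpace ℝ (Fin 3)) :
    rotZ θ (x - y) = rotZ θ x - rotZ θ y := by
  ext i
  fin_cases i <;> simp <;> ring

/-- `(θ, y) ↦ R_θ y` is jointly continuous. [folklore] -/
private theorem continuous_rotZ_prod'' :
    Continuous fun p : ℝ × EuclideanSpace ℝ (Fin 3) => rotZ p.1 p.2 := by
  unfold rotZ
  refine (PiLp.continuous_toLp 2 _).comp ?_
  refine continuous_pi fun i => ?_
  have h0 : Continuous fun p : ℝ × EuclideanSpace ℝ (Fin 3) => p.2 0 :=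
    (PiLp.continuous_apply 2 _ 0).comp continuous_snd
  have h1 : Continuous fun p : ℝ × EuclideanSpace ℝ (Fin 3) => p.2 1 :=
    (PiLp.continuous_apply 2 _ 1).comp continuous_snd
  have h2 : Continuous fun p : ℝ × EuclideanSpace ℝ (Fin 3) => p.2 2 :=
    (PiLp.continuous_apply 2 _ 2).comp continuous_snd
  have hc : Continuous fun p : ℝ × EuclideanSpace ℝ (Fin 3) => Real.cos p.1 :=
    Real.continuous_cos.comp continuous_fst
  have hs : Continuous fun p : ℝ × EuclideanSpace ℝ (Fin 3) => Real.sin p.1 :=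
    Real.continuous_sin.comp continuous_fst
  fin_cases i
  · exact ((hc.mul h0).sub (hs.mul h1)).congr fun p => by simp
  · exact ((hs.mul h0).add (hc.mul h1)).congr fun p => by simp
  · exact h2.congr fun p => by simp

/-- **The distance between a meridian point and a rotated meridian point**:
`‖(r, 0, z) − R_ψ (r', 0, z')‖² = (r − r')² + (z − z')² + 2 r r' (1 − cos ψ)`. [folklore] -/
private theorem norm_meridianPoint_sub_rotZ_meridianPoint_sq (r z r' z' ψ : ℝ) :
    ‖meridianPoint (r, z) - rotZ ψ (meridianPoint (r', z'))‖ ^ 2 =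
      (r - r') ^ 2 + (z - z') ^ 2 + 2 * r * r' * (1 - Real.cos ψ) := by
  rw [EuclideanSpace.norm_eq, Real.sq_sqrt (Finset.sum_nonneg fun i _ => sq_nonneg _)]
  simp only [Fin.sum_univ_three, Real.norm_eq_abs, sq_abs, PiLp.sub_apply, rotZ_apply_zero,
    rotZ_apply_one, rotZ_apply_two, meridianPoint_apply_zero, meridianPoint_apply_one,
    meridianPoint_apply_two]
  linear_combination (r' ^ 2) * Real.sin_sq_add_cos_sq ψ

/-- **Reduction of `‖x − R_φ y‖` to meridian points**: with `x = R_α x_m`, `y = R_β y_m`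
(`rotZ_arg_meridianPoint`), `‖x − R_φ y‖ = ‖x_m − R_{φ + β − α} y_m‖`. [folklore] -/
private theorem norm_sub_rotZ_eq_meridian (x y : EuclideanSpace ℝ (Fin 3)) (φ : ℝ) :
    ‖x - rotZ φ y‖ = ‖meridianPoint (meridian x) -
      rotZ (φ + Complex.arg ⟨y 0, y 1⟩ - Complex.arg ⟨x 0, x 1⟩) (meridianPoint (meridian y))‖ := by
  set α : ℝ := Complex.arg ⟨x 0, x 1⟩
  set β : ℝ := Complex.arg ⟨y 0, y 1⟩
  conv_lhs => rw [← rotZ_arg_meridianPoint x, ← rotZ_arg_meridianPoint y]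
  have h : rotZ φ (rotZ β (meridianPoint (meridian y))) =
      rotZ α (rotZ (φ + β - α) (meridianPoint (meridian y))) := by
    rw [← rotZ_add, ← rotZ_add]; congr 1; ring
  rw [h, ← rotZ_sub', norm_rotZ]

/-- The cylindrical radius is `1`-Lipschitz: `r(y) ≤ r(x) + ‖x − y‖`. [folklore] -/
private theorem cylRadius_le_cylRadius_add_norm_sub_aux (x y : EuclideanSpace ℝ (Fin 3)) :
    cylRadius y ≤ cylRadius x + ‖x - y‖ := by
  have hx := cylRadius_sq x
  have hxy := cylRadius_sq (x - y)
  have hx0 := cylRadius_nonneg x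
  have hxy0 := cylRadius_nonneg (x - y)
  have hle : cylRadius (x - y) ≤ ‖x - y‖ := by
    rw [cylRadius, EuclideanSpace.norm_eq]
    refine Real.sqrt_le_sqrt ?_
    simp only [Fin.sum_univ_three, Real.norm_eq_abs, sq_abs, PiLp.sub_apply]
    nlinarith [sq_nonneg (x 2 - y 2)]
  have h1 : cylRadius y ≤ cylRadius x + cylRadius (x - y) := by
    rw [cylRadius, Real.sqrt_le_iff]
    refine ⟨by positivity, ?_⟩
    simp only [PiLp.sub_apply] at hxy
    nlinarith [sq_nonneg (x 0 * (x 1 - y 1) - x 1 * (x 0 - y 0)),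
      mul_nonneg hx0 hxy0, sq_nonneg (x 0 * (x 0 - y 0) + x 1 * (x 1 - y 1) + cylRadius x * cylRadius (x - y))]
  linarith

/-- Jordan's inequality in the form `2 ψ²/π² ≤ 1 − cos ψ` for `|ψ| ≤ π`. [folklore] -/
private theorem two_mul_sq_div_pi_sq_le_one_sub_cos {ψ : ℝ} (h : |ψ| ≤ π) :
    2 * ψ ^ 2 / π ^ 2 ≤ 1 - Real.cos ψ := by
  -- `1 − cos ψ = 2 sin²(ψ/2)` and `sin(|ψ|/2) ≥ |ψ|/π`
  have hcos : 1 - Real.cos ψ = 2 * Real.sin (|ψ| / 2) ^ 2 := by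
    have h1 : Real.cos ψ = Real.cos |ψ| := by
      rcases abs_choice ψ with h' | h'
      · rw [h']
      · rw [h', Real.cos_neg]
    rw [h1]
    have := Real.sin_sq_add_cos_sq (|ψ| / 2)
    have e : Real.cos |ψ| = Real.cos (2 * (|ψ| / 2)) := by ring_nf
    rw [e, Real.cos_two_mul]
    linarith
  have hj : 2 / π * (|ψ| / 2) ≤ Real.sin (|ψ| / 2) :=
    Real.mul_le_sin (by positivity) (by linarith)
  have hπ : 0 < π := Real.pi_pos
  have hl : 0 ≤ 2 / π * (|ψ| / 2) := by positivity
  have hsq : (2 / π * (|ψ| / 2)) ^ 2 ≤ Real.sin (|ψ| / 2) ^ 2 :=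
    pow_le_pow_left₀ hl hj 2
  have e1 : 2 / π * (|ψ| / 2) = |ψ| / π := by
    field_simp
  rw [e1, div_pow, sq_abs] at hsq
  rw [hcos]
  have e3 : 2 * ψ ^ 2 / π ^ 2 = 2 * (ψ ^ 2 / π ^ 2) := by ring
  rw [e3]
  linarith

end Geometry

/-! ### The one-dimensional angular integral -/

section Angular

/-- A bounded measurable real function is interval integrable. [folklore] -/
private theorem intervalIntegrable_of_bounded {f : ℝ → ℝ} {B : ℝ} (hf : Measurable f)
    (hB : ∀ x, |f x| ≤ B) (a b : ℝ) : IntervalIntegrable f volume a b :=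
  (intervalIntegrable_const (c := B)).mono_fun' hf.aestronglyMeasurable
    (Eventually.of_forall fun x => by simpa only [Real.norm_eq_abs] using hB x)

/-- `∫_{−π}^{π} dψ/(a² + b²ψ²) ≤ π/(ab)` for `a, b > 0` (the integral equals
`(2/(ab)) arctan(bπ/a)`). [folklore] -/
private theorem intervalIntegral_inv_sq_add_sq_mul_sq_le {a b : ℝ} (ha : 0 < a) (hb : 0 < b) :
    ∫ ψ in (-π)..π, (a ^ 2 + b ^ 2 * ψ ^ 2)⁻¹ ≤ π / (a * b) := by
  set c : ℝ := b / a with hc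
  have hc0 : 0 < c := div_pos hb ha
  have hpt : (fun ψ : ℝ => (a ^ 2 + b ^ 2 * ψ ^ 2)⁻¹) =
      fun ψ => (a ^ 2)⁻¹ * (1 + (c * ψ) ^ 2)⁻¹ := by
    funext ψ
    rw [← mul_inv]
    congr 1
    rw [hc]
    field_simp
  rw [hpt, intervalIntegral.integral_const_mul,
    intervalIntegral.integral_comp_mul_left (fun u : ℝ => (1 + u ^ 2)⁻¹) hc0.ne',
    integral_inv_one_add_sq, smul_eq_mul]
  have h1 := Real.arctan_lt_pi_div_two (c * π)
  have h2 := Real.neg_pi_div_two_lt_arctan (c * -π)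
  have h3 : Real.arctan (c * π) - Real.arctan (c * -π) ≤ π := by linarith
  calc (a ^ 2)⁻¹ * (c⁻¹ * (Real.arctan (c * π) - Real.arctan (c * -π)))
      ≤ (a ^ 2)⁻¹ * (c⁻¹ * π) := by gcongr
    _ = π / (a * b) := by rw [hc]; field_simp

/-- **The angular integral of the far kernel.** For `r ≥ 2ρ > 0`, `r' ≥ 0`, `h ∈ ℝ` and
`q(ψ) = (r − r')² + h² + 2rr'(1 − cos ψ)` (the squared distance between the points with
cylindrical coordinates `(r, 0, z)` and `(r', ψ, z')`, `h = z − z'`):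
`∫_{−π}^{π} 1_{q ≥ ρ²} q⁻¹ dψ ≤ 20/(ρ r)`. (If `r' ≤ r/4` then `q ≥ (3r/4)²`; otherwise
`q ≥ max(ρ², (4rr'/π²)ψ²)` by Jordan's inequality, and `∫ 2 dψ/(ρ² + (4rr'/π²)ψ²) ≤ π²/(ρ√(rr'))`
with `√(rr') ≥ r/2`.) [folklore] -/
private theorem intervalIntegral_far_kernel_le {r r' h ρ : ℝ} (hr' : 0 ≤ r') (hρ : 0 < ρ)
    (hrρ : 2 * ρ ≤ r) :
    ∫ ψ in (-π)..π, (Ici (ρ ^ 2)).indicator (fun q : ℝ => q⁻¹)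
        ((r - r') ^ 2 + h ^ 2 + 2 * r * r' * (1 - Real.cos ψ)) ≤ 20 / (ρ * r) := by
  have hr : 0 < r := by linarith
  have hπ := Real.pi_pos
  have hπ3 := Real.pi_gt_three
  have hπ4 := Real.pi_lt_d2
  set f : ℝ → ℝ := fun ψ => (Ici (ρ ^ 2)).indicator (fun q : ℝ => q⁻¹)
    ((r - r') ^ 2 + h ^ 2 + 2 * r * r' * (1 - Real.cos ψ)) with hf
  have hq0 : ∀ ψ, (r - r') ^ 2 ≤ (r - r') ^ 2 + h ^ 2 + 2 * r * r' * (1 - Real.cos ψ) := fun ψ => by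
    nlinarith [Real.cos_le_one ψ, sq_nonneg h, mul_nonneg hr.le hr']
  -- the value of `f`
  have hfval : ∀ ψ, f ψ = if ρ ^ 2 ≤ (r - r') ^ 2 + h ^ 2 + 2 * r * r' * (1 - Real.cos ψ) then
      ((r - r') ^ 2 + h ^ 2 + 2 * r * r' * (1 - Real.cos ψ))⁻¹ else 0 := fun ψ => by
    simp only [hf, indicator, mem_Ici]
  have hf0 : ∀ ψ, 0 ≤ f ψ := fun ψ => by
    rw [hfval]
    split_ifs with hψ
    · exact inv_nonneg.2 ((sq_nonneg _).trans (hq0 ψ))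
    · exact le_rfl
  have hfρ : ∀ ψ, f ψ ≤ (ρ ^ 2)⁻¹ := fun ψ => by
    rw [hfval]
    split_ifs with hψ
    · exact inv_anti₀ (by positivity) hψ
    · positivity
  have hfm : Measurable f := by
    refine (measurable_inv.indicator measurableSet_Ici).comp ?_
    exact (continuous_const.add (continuous_const.mul
      (continuous_const.sub Real.continuous_cos))).measurable
  have hfi : ∀ a b, IntervalIntegrable f volume a b :=
    intervalIntegrable_of_bounded hfm (fun ψ => by
      rw [abs_of_nonneg (hf0 ψ)]; exact hfρ ψ)
  by_cases hcase : 4 * r' ≤ r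
  · -- (a) the two circles are far apart: `q ≥ (3r/4)²`
    have hpt : ∀ ψ, f ψ ≤ 16 / (9 * r ^ 2) := fun ψ => by
      rw [hfval]
      split_ifs with hψ
      · have h34 : (3 * r / 4) ^ 2 ≤ (r - r') ^ 2 := by nlinarith
        calc ((r - r') ^ 2 + h ^ 2 + 2 * r * r' * (1 - Real.cos ψ))⁻¹ ≤ ((3 * r / 4) ^ 2)⁻¹ :=
              inv_anti₀ (by positivity) (h34.trans (hq0 ψ))
          _ = 16 / (9 * r ^ 2) := by field_simp; ring
      · positivity
    calc ∫ ψ in (-π)..π, f ψ ≤ ∫ ψ in (-π)..π, (16 / (9 * r ^ 2) : ℝ) :=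
          intervalIntegral.integral_mono_on (by linarith) (hfi _ _) intervalIntegrable_const
            fun ψ _ => hpt ψ
      _ = (32 * π) / (9 * r ^ 2) := by rw [intervalIntegral.integral_const, smul_eq_mul]; ring
      _ ≤ 20 / (ρ * r) := by
          rw [div_le_div_iff₀ (by positivity) (by positivity)]
          nlinarith [mul_nonneg (mul_nonneg hρ.le hr.le) (by linarith : (0:ℝ) ≤ 3.15 - π),
            mul_le_mul_of_nonneg_right hrρ hr.le, sq_nonneg r, hπ.le]
  · -- (b) `r' > r/4`: Jordan's inequality
    rw [not_le] at hcase
    have hr'0 : 0 < r' := by linarith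
    set b : ℝ := 2 * Real.sqrt (r * r') / π with hb
    have hsq : Real.sqrt (r * r') ^ 2 = r * r' := Real.sq_sqrt (by positivity)
    have hsq0 : 0 < Real.sqrt (r * r') := Real.sqrt_pos.2 (by positivity)
    have hb0 : 0 < b := by positivity
    have hb2 : b ^ 2 = 4 * r * r' / π ^ 2 := by
      rw [hb, div_pow, mul_pow, hsq]; ring
    have hpt : ∀ ψ ∈ Icc (-π) π, f ψ ≤ 2 * (ρ ^ 2 + b ^ 2 * ψ ^ 2)⁻¹ := by
      intro ψ hψ
      have hjordan := two_mul_sq_div_pi_sq_le_one_sub_cos (abs_le.2 ⟨hψ.1, hψ.2⟩)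
      rw [hfval]
      split_ifs with hρq
      · have hk : b ^ 2 * ψ ^ 2 ≤ (r - r') ^ 2 + h ^ 2 + 2 * r * r' * (1 - Real.cos ψ) := by
          rw [hb2]
          have : 4 * r * r' / π ^ 2 * ψ ^ 2 = 2 * r * r' * (2 * ψ ^ 2 / π ^ 2) := by
            field_simp
            ring
          rw [this]
          nlinarith [mul_pos hr hr'0, sq_nonneg h, sq_nonneg (r - r')]
        have hpos : 0 < (ρ ^ 2 + b ^ 2 * ψ ^ 2) / 2 := by
          have h1 : 0 < ρ ^ 2 := pow_pos hρ 2
          have h2 : 0 ≤ b ^ 2 * ψ ^ 2 := by positivity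
          linarith
        have e : 2 * (ρ ^ 2 + b ^ 2 * ψ ^ 2)⁻¹ = ((ρ ^ 2 + b ^ 2 * ψ ^ 2) / 2)⁻¹ := by
          rw [inv_div]; ring
        rw [e]
        exact inv_anti₀ hpos (by linarith)
      · positivity
    have hcont : Continuous fun ψ : ℝ => 2 * (ρ ^ 2 + b ^ 2 * ψ ^ 2)⁻¹ := by
      refine continuous_const.mul ((continuous_const.add
        (continuous_const.mul (continuous_pow 2))).inv₀ fun ψ => ?_)
      have h1 : 0 < ρ ^ 2 := pow_pos hρ 2
      have h2 : 0 ≤ b ^ 2 * ψ ^ 2 := by positivity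
      exact (by linarith : 0 < ρ ^ 2 + b ^ 2 * ψ ^ 2).ne'
    calc ∫ ψ in (-π)..π, f ψ ≤ ∫ ψ in (-π)..π, 2 * (ρ ^ 2 + b ^ 2 * ψ ^ 2)⁻¹ :=
          intervalIntegral.integral_mono_on (by linarith) (hfi _ _)
            (hcont.intervalIntegrable _ _) hpt
      _ = 2 * ∫ ψ in (-π)..π, (ρ ^ 2 + b ^ 2 * ψ ^ 2)⁻¹ := intervalIntegral.integral_const_mul _ _
      _ ≤ 2 * (π / (ρ * b)) := by
          gcongr
          exact intervalIntegral_inv_sq_add_sq_mul_sq_le hρ hb0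
      _ = π ^ 2 / (ρ * Real.sqrt (r * r')) := by rw [hb]; field_simp
      _ ≤ 20 / (ρ * r) := by
          -- `√(rr') ≥ r/2` and `π² < 10`
          have hge : r / 2 ≤ Real.sqrt (r * r') := by
            rw [Real.le_sqrt (by positivity) (by positivity)]
            nlinarith
          rw [div_le_div_iff₀ (by positivity) (by positivity)]
          have hπ2 : π ^ 2 < 10 := by nlinarith
          nlinarith [mul_pos hρ hr, mul_le_mul_of_nonneg_left hge (by positivity : (0:ℝ) ≤ ρ * 20)]

end Angular

/-! ### Rotation averaging of an axisymmetric weight against a kernel -/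

section Averaging

/-- Substituting `y ↦ R_θ y` (a volume-preserving map): for a rotation-invariant weight `a`,
`∫ a(y) G(R_θ y) dy = ∫ a(y) G(y) dy`. [folklore] -/
private theorem lintegral_mul_comp_rotZ_eq {a G : EuclideanSpace ℝ (Fin 3) → ℝ≥0∞}
    (ha : ∀ θ y, a (rotZ θ y) = a y) (θ : ℝ) :
    ∫⁻ y, a y * G (rotZ θ y) = ∫⁻ y, a y * G y := by
  have hmp : MeasurePreserving (rotZ θ) (volume : Measure (EuclideanSpace ℝ (Fin 3))) volume :=
    (rotZLIE θ).measurePreserving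
  have hme : MeasurableEmbedding (rotZ θ) := (rotZLIE θ).toHomeomorph.measurableEmbedding
  have h := hmp.lintegral_comp_emb hme (fun z => a z * G z)
  simp only [ha] at h
  exact h

/-- **Rotation averaging (Tonelli).** For a measurable rotation-invariant weight `a ≥ 0` and a
measurable kernel `G ≥ 0` on `ℝ³`:
`2π ∫ a G = ∫ a(y) (∫_{−π}^{π} G(R_φ y) dφ) dy`. [folklore] -/
private theorem ofReal_two_pi_mul_lintegral_mul_eq {a G : EuclideanSpace ℝ (Fin 3) → ℝ≥0∞}
    (ha : ∀ θ y, a (rotZ θ y) = a y) (ham : Measurable a) (hG : Measurable G) :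
    ENNReal.ofReal (2 * π) * ∫⁻ y, a y * G y =
      ∫⁻ y, a y * ∫⁻ φ in Ioc (-π) π, G (rotZ φ y) := by
  have hvol : volume (Ioc (-π) π) = ENNReal.ofReal (2 * π) := by
    rw [Real.volume_Ioc]; congr 1; ring
  have hrot : Measurable fun p : ℝ × EuclideanSpace ℝ (Fin 3) => rotZ p.1 p.2 :=
    continuous_rotZ_prod''.measurable
  calc ENNReal.ofReal (2 * π) * ∫⁻ y, a y * G y
      = ∫⁻ _ in Ioc (-π) π, ∫⁻ y, a y * G y := by rw [setLIntegral_const, hvol, mul_comm]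
    _ = ∫⁻ φ in Ioc (-π) π, ∫⁻ y, a y * G (rotZ φ y) :=
        lintegral_congr fun φ => (lintegral_mul_comp_rotZ_eq ha φ).symm
    _ = ∫⁻ y, ∫⁻ φ in Ioc (-π) π, a y * G (rotZ φ y) := by
        have hF : Measurable
            (fun p : ℝ × EuclideanSpace ℝ (Fin 3) => a p.2 * G (rotZ p.1 p.2)) :=
          (ham.comp measurable_snd).mul (hG.comp hrot)
        exact lintegral_lintegral_swap hF.aemeasurable
    _ = ∫⁻ y, a y * ∫⁻ φ in Ioc (-π) π, G (rotZ φ y) := by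
        refine lintegral_congr fun y => ?_
        have hm0 : Measurable fun φ : ℝ => rotZ φ y :=
          (continuous_rotZ_prod''.comp (continuous_id.prodMk continuous_const)).measurable
        have hm : Measurable fun φ : ℝ => G (rotZ φ y) := hG.comp hm0
        rw [lintegral_const_mul _ hm]

/-- Consequence: if every orbit integral of the kernel is at most `B`, then
`2π ∫ a G ≤ B ∫ a`. [folklore] -/
private theorem ofReal_two_pi_mul_lintegral_mul_le {a G : EuclideanSpace ℝ (Fin 3) → ℝ≥0∞} {B : ℝ≥0∞}
    (ha : ∀ θ y, a (rotZ θ y) = a y) (ham : Measurable a) (hG : Measurable G)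
    (hB : ∀ y, ∫⁻ φ in Ioc (-π) π, G (rotZ φ y) ≤ B) :
    ENNReal.ofReal (2 * π) * ∫⁻ y, a y * G y ≤ B * ∫⁻ y, a y := by
  rw [ofReal_two_pi_mul_lintegral_mul_eq ha ham hG]
  calc ∫⁻ y, a y * ∫⁻ φ in Ioc (-π) π, G (rotZ φ y) ≤ ∫⁻ y, a y * B :=
        lintegral_mono fun y => mul_le_mul_right (hB y) _
    _ = B * ∫⁻ y, a y := by rw [lintegral_mul_const B ham, mul_comm]

end Averaging

/-! ### The far field: orbit integrals of `1_{|x−y| ≥ ρ} |x − y|⁻²` -/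

section FarField

/-- `1_{s ≥ ρ} s⁻² = 1_{s² ≥ ρ²} (s²)⁻¹` for `s ≥ 0`, `ρ > 0`. [folklore] -/
private theorem indicator_Ici_sq_eq {ρ s : ℝ} (hρ : 0 < ρ) (hs : 0 ≤ s) :
    (Ici ρ).indicator (fun s : ℝ => (s ^ 2)⁻¹) s =
      (Ici (ρ ^ 2)).indicator (fun q : ℝ => q⁻¹) (s ^ 2) := by
  by_cases h : ρ ≤ s
  · rw [indicator_of_mem (show s ∈ Ici ρ from h),
      indicator_of_mem (show s ^ 2 ∈ Ici (ρ ^ 2) from pow_le_pow_left₀ hρ.le h 2)]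
  · have h' : s ^ 2 ∉ Ici (ρ ^ 2) := fun h2 => h (by
      have h2 : ρ ^ 2 ≤ s ^ 2 := h2
      nlinarith)
    rw [indicator_of_notMem (show s ∉ Ici ρ from h), indicator_of_notMem h']

/-- The far kernel along an orbit, in meridian coordinates: with `r = r(x)`, `r' = r(y)`,
`h = x₂ − y₂` and `c = arg(y) − arg(x)`,
`1_{|x − R_φ y| ≥ ρ} |x − R_φ y|⁻² = f(φ + c)`, `f(ψ) = 1_{q(ψ) ≥ ρ²} q(ψ)⁻¹`,
`q(ψ) = (r − r')² + h² + 2rr'(1 − cos ψ)`. [folklore] -/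
private theorem far_kernel_rotZ_eq (x y : EuclideanSpace ℝ (Fin 3)) {ρ : ℝ} (hρ : 0 < ρ) (φ : ℝ) :
    (Ici ρ).indicator (fun s : ℝ => (s ^ 2)⁻¹) ‖x - rotZ φ y‖ =
      (Ici (ρ ^ 2)).indicator (fun q : ℝ => q⁻¹)
        ((cylRadius x - cylRadius y) ^ 2 + (x 2 - y 2) ^ 2 +
          2 * cylRadius x * cylRadius y *
            (1 - Real.cos (φ + Complex.arg ⟨y 0, y 1⟩ - Complex.arg ⟨x 0, x 1⟩))) := by
  rw [indicator_Ici_sq_eq hρ (norm_nonneg _), norm_sub_rotZ_eq_meridian, meridian_apply,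
    meridian_apply, norm_meridianPoint_sub_rotZ_meridianPoint_sq]

/-- **The orbit integral of the far kernel**: for `r(x) ≥ 2ρ > 0` and every `y`,
`∫_{−π}^{π} 1_{|x − R_φ y| ≥ ρ} |x − R_φ y|⁻² dφ ≤ 20/(ρ r(x))`. [folklore] -/
private theorem lintegral_orbit_far_kernel_le (x y : EuclideanSpace ℝ (Fin 3)) {ρ : ℝ} (hρ : 0 < ρ)
    (hrρ : 2 * ρ ≤ cylRadius x) :
    ∫⁻ φ in Ioc (-π) π, ENNReal.ofReal ((Ici ρ).indicator (fun s : ℝ => (s ^ 2)⁻¹) ‖x - rotZ φ y‖) ≤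
      ENNReal.ofReal (20 / (ρ * cylRadius x)) := by
  set r := cylRadius x with hr
  set r' := cylRadius y with hr'
  set h := x 2 - y 2 with hh
  set c := Complex.arg ⟨y 0, y 1⟩ - Complex.arg ⟨x 0, x 1⟩ with hc
  set f : ℝ → ℝ := fun ψ => (Ici (ρ ^ 2)).indicator (fun q : ℝ => q⁻¹)
    ((r - r') ^ 2 + h ^ 2 + 2 * r * r' * (1 - Real.cos ψ)) with hf
  have hP : ∀ φ, (Ici ρ).indicator (fun s : ℝ => (s ^ 2)⁻¹) ‖x - rotZ φ y‖ = f (φ + c) := by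
    intro φ
    rw [far_kernel_rotZ_eq x y hρ φ, hf]
    simp only [hr, hr', hh, hc]
    ring_nf
  simp_rw [hP]
  -- properties of `f`
  have hq0 : ∀ ψ, 0 ≤ (r - r') ^ 2 + h ^ 2 + 2 * r * r' * (1 - Real.cos ψ) := fun ψ => by
    nlinarith [Real.cos_le_one ψ, sq_nonneg h, sq_nonneg (r - r'),
      mul_nonneg (cylRadius_nonneg x) (cylRadius_nonneg y)]
  have hf0 : ∀ ψ, 0 ≤ f ψ := fun ψ => by
    simp only [hf, indicator, mem_Ici]
    split_ifs
    · exact inv_nonneg.2 (hq0 ψ)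
    · exact le_rfl
  have hfρ : ∀ ψ, f ψ ≤ (ρ ^ 2)⁻¹ := fun ψ => by
    simp only [hf, indicator, mem_Ici]
    split_ifs with hψ
    · exact inv_anti₀ (by positivity) hψ
    · positivity
  have hfm : Measurable f := by
    refine (measurable_inv.indicator measurableSet_Ici).comp ?_
    exact (continuous_const.add (continuous_const.mul
      (continuous_const.sub Real.continuous_cos))).measurable
  have hper : Function.Periodic f (2 * π) := fun ψ => by
    simp only [hf, Real.cos_add_two_pi]
  have hmeas : Measurable (fun φ => f (φ + c)) := hfm.comp (measurable_id.add_const c)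
  have hfi : IntegrableOn (fun φ => f (φ + c)) (Ioc (-π) π) :=
    (intervalIntegrable_of_bounded (B := (ρ ^ 2)⁻¹) hmeas
      (fun φ => by rw [abs_of_nonneg (hf0 _)]; exact hfρ _) (-π) π).1
  rw [← ofReal_integral_eq_lintegral_ofReal hfi (Eventually.of_forall fun φ => hf0 _)]
  refine ENNReal.ofReal_le_ofReal ?_
  have hππ : -π ≤ π := by linarith [Real.pi_pos]
  rw [← intervalIntegral.integral_of_le hππ, intervalIntegral.integral_comp_add_right f c,
    show π + c = -π + c + 2 * π by ring, hper.intervalIntegral_add_eq (-π + c) (-π),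
    show -π + 2 * π = π by ring]
  exact intervalIntegral_far_kernel_le (cylRadius_nonneg y) hρ hrρ

/-- **The far-field bound.** For `w` with rotation-invariant norm (`‖w(R_θ y)‖ = ‖w(y)‖`,
continuous) and `r(x) ≥ 2ρ > 0`:
`∫ ‖w(y)‖ 1_{|x−y| ≥ ρ} |x − y|⁻² dy ≤ (10/(π ρ r(x))) ∫ ‖w‖` (rotation averaging and the orbit
bound `20/(ρ r)`, divided by `2π`). [folklore] -/
private theorem lintegral_enorm_mul_far_kernel_le {w : EuclideanSpace ℝ (Fin 3) → EuclideanSpace ℝ (Fin 3)}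
    (hwc : Continuous w) (hw : ∀ θ y, ‖w (rotZ θ y)‖ = ‖w y‖) (x : EuclideanSpace ℝ (Fin 3))
    {ρ : ℝ} (hρ : 0 < ρ) (hrρ : 2 * ρ ≤ cylRadius x) :
    ∫⁻ y, ‖w y‖ₑ * ENNReal.ofReal ((Ici ρ).indicator (fun s : ℝ => (s ^ 2)⁻¹) ‖x - y‖) ≤
      ENNReal.ofReal (10 / (π * ρ * cylRadius x)) * ∫⁻ y, ‖w y‖ₑ := by
  have hr : 0 < cylRadius x := by linarith
  have ha : ∀ θ y, ‖w (rotZ θ y)‖ₑ = ‖w y‖ₑ := fun θ y => by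
    rw [← ofReal_norm, ← ofReal_norm, hw]
  have ham : Measurable fun y => ‖w y‖ₑ := hwc.measurable.enorm
  have he : Measurable ((Ici ρ).indicator fun s : ℝ => (s ^ 2)⁻¹) :=
    ((measurable_id.pow_const 2).inv).indicator measurableSet_Ici
  have hG : Measurable fun y : EuclideanSpace ℝ (Fin 3) =>
      ENNReal.ofReal ((Ici ρ).indicator (fun s : ℝ => (s ^ 2)⁻¹) ‖x - y‖) :=
    (he.comp (measurable_const.sub measurable_id).norm).ennreal_ofReal
  have key := ofReal_two_pi_mul_lintegral_mul_le ha ham hG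
    (fun y => lintegral_orbit_far_kernel_le x y hρ hrρ)
  have e : ENNReal.ofReal (20 / (ρ * cylRadius x)) =
      ENNReal.ofReal (2 * π) * ENNReal.ofReal (10 / (π * ρ * cylRadius x)) := by
    rw [← ENNReal.ofReal_mul (by positivity)]
    congr 1
    field_simp
    ring
  rw [e, mul_assoc] at key
  exact (ENNReal.mul_le_mul_iff_right (ENNReal.ofReal_pos.2 (by positivity)).ne'
    ENNReal.ofReal_ne_top).1 key

/-- The trivial far-field bound `∫ ‖w‖ 1_{|x−y| ≥ ρ}|x−y|⁻² ≤ ρ⁻² ∫ ‖w‖`. [folklore] -/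
private theorem lintegral_enorm_mul_far_kernel_le_inv_sq (w : EuclideanSpace ℝ (Fin 3) → EuclideanSpace ℝ (Fin 3))
    (x : EuclideanSpace ℝ (Fin 3)) {ρ : ℝ} (hρ : 0 < ρ) :
    ∫⁻ y, ‖w y‖ₑ * ENNReal.ofReal ((Ici ρ).indicator (fun s : ℝ => (s ^ 2)⁻¹) ‖x - y‖) ≤
      ENNReal.ofReal ((ρ ^ 2)⁻¹) * ∫⁻ y, ‖w y‖ₑ := by
  rw [← lintegral_const_mul' _ _ ENNReal.ofReal_ne_top]
  refine lintegral_mono fun y => ?_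
  have h1 : ENNReal.ofReal ((Ici ρ).indicator (fun s : ℝ => (s ^ 2)⁻¹) ‖x - y‖) ≤
      ENNReal.ofReal ((ρ ^ 2)⁻¹) := by
    refine ENNReal.ofReal_le_ofReal ?_
    simp only [indicator, mem_Ici]
    split_ifs with h
    · exact inv_anti₀ (by positivity) (pow_le_pow_left₀ hρ.le h 2)
    · positivity
  calc ‖w y‖ₑ * ENNReal.ofReal ((Ici ρ).indicator (fun s : ℝ => (s ^ 2)⁻¹) ‖x - y‖)
      ≤ ‖w y‖ₑ * ENNReal.ofReal ((ρ ^ 2)⁻¹) := mul_le_mul' le_rfl h1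
    _ = ENNReal.ofReal ((ρ ^ 2)⁻¹) * ‖w y‖ₑ := mul_comm _ _

end FarField

/-! ### The near field -/

section NearField

/-- **The near-field bound**: if `‖w(y)‖ ≤ M r(y)` (`M ≥ 0`) then
`∫ ‖w(y)‖ 1_{|x−y|<ρ} |x−y|⁻² dy ≤ M (r(x) + ρ) · 4πρ` (`r(y) ≤ r(x) + ρ` on the ball, and
`∫_{|z|<ρ}|z|⁻² = 4πρ`). [folklore] -/
private theorem lintegral_enorm_mul_kernelMajorant_le {w : EuclideanSpace ℝ (Fin 3) → EuclideanSpace ℝ (Fin 3)}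
    {M : ℝ} (hM : 0 ≤ M) (hwM : ∀ y, ‖w y‖ ≤ M * cylRadius y) (x : EuclideanSpace ℝ (Fin 3))
    {ρ : ℝ} (hρ : 0 < ρ) :
    ∫⁻ y, ‖w y‖ₑ * ENNReal.ofReal (kernelMajorant ρ (x - y)) ≤
      ENNReal.ofReal (M * (cylRadius x + ρ) * (4 * π * ρ)) := by
  have hpt : ∀ y, ‖w y‖ₑ * ENNReal.ofReal (kernelMajorant ρ (x - y)) ≤
      ENNReal.ofReal (M * (cylRadius x + ρ)) * ENNReal.ofReal (kernelMajorant ρ (x - y)) := by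
    intro y
    by_cases hy : x - y ∈ ball (0 : EuclideanSpace ℝ (Fin 3)) ρ
    · have h1 : ‖w y‖ₑ ≤ ENNReal.ofReal (M * (cylRadius x + ρ)) := by
        rw [← ofReal_norm]
        refine ENNReal.ofReal_le_ofReal ((hwM y).trans (mul_le_mul_of_nonneg_left ?_ hM))
        rw [mem_ball_zero_iff] at hy
        linarith [cylRadius_le_cylRadius_add_norm_sub_aux x y]
      exact mul_le_mul' h1 le_rfl
    · have : kernelMajorant ρ (x - y) = 0 := indicator_of_notMem hy _
      rw [this, ENNReal.ofReal_zero, mul_zero, mul_zero]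
  have hmk : Measurable fun y : EuclideanSpace ℝ (Fin 3) => ENNReal.ofReal (kernelMajorant ρ (x - y)) :=
    ((measurable_kernelMajorant ρ).comp (measurable_const.sub measurable_id)).ennreal_ofReal
  calc ∫⁻ y, ‖w y‖ₑ * ENNReal.ofReal (kernelMajorant ρ (x - y))
      ≤ ∫⁻ y, ENNReal.ofReal (M * (cylRadius x + ρ)) * ENNReal.ofReal (kernelMajorant ρ (x - y)) :=
        lintegral_mono hpt
    _ = ENNReal.ofReal (M * (cylRadius x + ρ)) * ENNReal.ofReal (4 * π * ρ) := by
        rw [lintegral_const_mul _ hmk, lintegral_sub_left_eq_self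
          (μ := (volume : Measure (EuclideanSpace ℝ (Fin 3))))
          (fun z => ENNReal.ofReal (kernelMajorant ρ z)) x, lintegral_kernelMajorant hρ.le]
    _ = ENNReal.ofReal (M * (cylRadius x + ρ) * (4 * π * ρ)) :=
        (ENNReal.ofReal_mul (mul_nonneg hM (add_nonneg (cylRadius_nonneg x) hρ.le))).symm

end NearField

/-! ### Assembly: the sup bound with an explicit constant -/

section Assembly

/-- Splitting of the kernel majorant at scale `ρ > 0`:
`|v|⁻² = 1_{|v|<ρ}|v|⁻² + 1_{|v| ≥ ρ}|v|⁻²`. [folklore] -/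
private theorem inv_norm_sq_eq_kernelMajorant_add (ρ : ℝ) (v : EuclideanSpace ℝ (Fin 3)) :
    (‖v‖ ^ 2)⁻¹ = kernelMajorant ρ v + (Ici ρ).indicator (fun s : ℝ => (s ^ 2)⁻¹) ‖v‖ := by
  by_cases h : ‖v‖ < ρ
  · have h1 : kernelMajorant ρ v = (‖v‖ ^ 2)⁻¹ := by
      simp [kernelMajorant, indicator, h]
    rw [h1, indicator_of_notMem (show ‖v‖ ∉ Ici ρ from fun h' => (not_le.2 h) h'), add_zero]
  · have h1 : kernelMajorant ρ v = 0 := by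
      simp [kernelMajorant, indicator, h]
    rw [h1, indicator_of_mem (show ‖v‖ ∈ Ici ρ from not_lt.1 h), zero_add]

/-- **Near/far splitting of the Biot–Savart integral**: for every `ρ` (of interest for `ρ > 0`),
`‖(K₃ ∗ w)(x)‖ ≤ (4π)⁻¹ (∫ ‖w‖ 1_{|x−y|<ρ}|x−y|⁻² + ∫ ‖w‖ 1_{|x−y|≥ρ}|x−y|⁻²)` (in `ℝ≥0∞`, through
`‖∫ f‖ₑ ≤ ∫⁻ ‖f‖ₑ` and `‖K₃(z) h‖ ≤ (4π)⁻¹‖h‖/|z|²`). [folklore] -/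
private theorem enorm_biotSavart_le_near_add_far {w : EuclideanSpace ℝ (Fin 3) → EuclideanSpace ℝ (Fin 3)}
    (hwm : Measurable fun y => ‖w y‖ₑ) (x : EuclideanSpace ℝ (Fin 3)) (ρ : ℝ) :
    ‖biotSavart w x‖ₑ ≤ ENNReal.ofReal ((4 * π)⁻¹) *
      ((∫⁻ y, ‖w y‖ₑ * ENNReal.ofReal (kernelMajorant ρ (x - y))) +
        ∫⁻ y, ‖w y‖ₑ * ENNReal.ofReal ((Ici ρ).indicator (fun s : ℝ => (s ^ 2)⁻¹) ‖x - y‖)) := by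
  have hc : (0 : ℝ) ≤ (4 * π)⁻¹ := by positivity
  have hpt : ∀ y, ‖biotSavartKernel (x - y) (w y)‖ₑ ≤ ENNReal.ofReal ((4 * π)⁻¹) *
      (‖w y‖ₑ * ENNReal.ofReal (kernelMajorant ρ (x - y)) +
        ‖w y‖ₑ * ENNReal.ofReal ((Ici ρ).indicator (fun s : ℝ => (s ^ 2)⁻¹) ‖x - y‖)) := by
    intro y
    rw [← mul_add, ← ENNReal.ofReal_add (kernelMajorant_nonneg _ _)
      (indicator_nonneg (fun _ _ => by positivity) _), ← inv_norm_sq_eq_kernelMajorant_add ρ,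
      ← ofReal_norm (w y), ← ofReal_norm, ← ENNReal.ofReal_mul (norm_nonneg _),
      ← ENNReal.ofReal_mul hc]
    refine ENNReal.ofReal_le_ofReal ?_
    rw [← mul_assoc]
    exact norm_biotSavartKernel_le _ _
  have hmk : Measurable fun y : EuclideanSpace ℝ (Fin 3) =>
      ‖w y‖ₑ * ENNReal.ofReal (kernelMajorant ρ (x - y)) :=
    hwm.mul ((measurable_kernelMajorant ρ).comp (measurable_const.sub measurable_id)).ennreal_ofReal
  rw [biotSavart]
  refine (enorm_integral_le_lintegral_enorm _).trans ((lintegral_mono hpt).trans ?_)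
  rw [lintegral_const_mul' _ _ ENNReal.ofReal_ne_top, lintegral_add_left hmk]

variable {w : EuclideanSpace ℝ (Fin 3) → EuclideanSpace ℝ (Fin 3)} {M : ℝ}

/-- **Sup bound at scale `ρ`, far from the axis** (`r(x) ≥ 2ρ > 0`): for continuous integrable
`w` with rotation-invariant norm and `‖w(y)‖ ≤ M r(y)`,
`‖(K₃ ∗ w)(x)‖ ≤ (4π)⁻¹ (M (r(x)+ρ) 4πρ + (10/(πρ r(x))) ∫‖w‖)`. [folklore] -/
private theorem norm_biotSavart_le_of_two_mul_le_cylRadius (hwc : Continuous w) (hwi : Integrable w)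
    (hw : ∀ θ y, ‖w (rotZ θ y)‖ = ‖w y‖) (hM : 0 ≤ M) (hwM : ∀ y, ‖w y‖ ≤ M * cylRadius y)
    (x : EuclideanSpace ℝ (Fin 3)) {ρ : ℝ} (hρ : 0 < ρ) (hrρ : 2 * ρ ≤ cylRadius x) :
    ‖biotSavart w x‖ ≤ (4 * π)⁻¹ * (M * (cylRadius x + ρ) * (4 * π * ρ) +
      10 / (π * ρ * cylRadius x) * ∫ y, ‖w y‖) := by
  have hr : 0 < cylRadius x := by linarith
  have hA0 : 0 ≤ ∫ y, ‖w y‖ := integral_nonneg fun _ => norm_nonneg _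
  have hA : ∫⁻ y, ‖w y‖ₑ = ENNReal.ofReal (∫ y, ‖w y‖) :=
    (ofReal_integral_norm_eq_lintegral_enorm hwi).symm
  have hwm : Measurable fun y => ‖w y‖ₑ := hwc.measurable.enorm
  have ha : 0 ≤ M * (cylRadius x + ρ) * (4 * π * ρ) :=
    mul_nonneg (mul_nonneg hM (add_nonneg hr.le hρ.le)) (by positivity)
  have hb : 0 ≤ 10 / (π * ρ * cylRadius x) * ∫ y, ‖w y‖ := mul_nonneg (by positivity) hA0
  have hN := lintegral_enorm_mul_kernelMajorant_le hM hwM x hρ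
  have hF := lintegral_enorm_mul_far_kernel_le hwc hw x hρ hrρ
  rw [hA, ← ENNReal.ofReal_mul (by positivity)] at hF
  have h2 : ‖biotSavart w x‖ₑ ≤ ENNReal.ofReal ((4 * π)⁻¹ * (M * (cylRadius x + ρ) * (4 * π * ρ) +
      10 / (π * ρ * cylRadius x) * ∫ y, ‖w y‖)) := by
    refine (enorm_biotSavart_le_near_add_far hwm x ρ).trans ?_
    rw [ENNReal.ofReal_mul (by positivity), ENNReal.ofReal_add ha hb]
    exact mul_le_mul' le_rfl (add_le_add hN hF)
  rw [← ofReal_norm] at h2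
  exact (ENNReal.ofReal_le_ofReal_iff (mul_nonneg (by positivity) (add_nonneg ha hb))).1 h2

/-- **Sup bound at scale `ρ`, unconditional far field**: for continuous integrable `w` with
`‖w(y)‖ ≤ M r(y)` and every `ρ > 0`,
`‖(K₃ ∗ w)(x)‖ ≤ (4π)⁻¹ (M (r(x)+ρ) 4πρ + ρ⁻² ∫‖w‖)`. [folklore] -/
private theorem norm_biotSavart_le_of_scale (hwc : Continuous w) (hwi : Integrable w) (hM : 0 ≤ M)
    (hwM : ∀ y, ‖w y‖ ≤ M * cylRadius y) (x : EuclideanSpace ℝ (Fin 3)) {ρ : ℝ} (hρ : 0 < ρ) :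
    ‖biotSavart w x‖ ≤ (4 * π)⁻¹ * (M * (cylRadius x + ρ) * (4 * π * ρ) +
      (ρ ^ 2)⁻¹ * ∫ y, ‖w y‖) := by
  have hA0 : 0 ≤ ∫ y, ‖w y‖ := integral_nonneg fun _ => norm_nonneg _
  have hA : ∫⁻ y, ‖w y‖ₑ = ENNReal.ofReal (∫ y, ‖w y‖) :=
    (ofReal_integral_norm_eq_lintegral_enorm hwi).symm
  have hwm : Measurable fun y => ‖w y‖ₑ := hwc.measurable.enorm
  have ha : 0 ≤ M * (cylRadius x + ρ) * (4 * π * ρ) :=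
    mul_nonneg (mul_nonneg hM (add_nonneg (cylRadius_nonneg x) hρ.le)) (by positivity)
  have hb : 0 ≤ (ρ ^ 2)⁻¹ * ∫ y, ‖w y‖ := mul_nonneg (by positivity) hA0
  have hN := lintegral_enorm_mul_kernelMajorant_le hM hwM x hρ
  have hF := lintegral_enorm_mul_far_kernel_le_inv_sq w x hρ
  rw [hA, ← ENNReal.ofReal_mul (by positivity)] at hF
  have h2 : ‖biotSavart w x‖ₑ ≤ ENNReal.ofReal ((4 * π)⁻¹ * (M * (cylRadius x + ρ) * (4 * π * ρ) +
      (ρ ^ 2)⁻¹ * ∫ y, ‖w y‖)) := by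
    refine (enorm_biotSavart_le_near_add_far hwm x ρ).trans ?_
    rw [ENNReal.ofReal_mul (by positivity), ENNReal.ofReal_add ha hb]
    exact mul_le_mul' le_rfl (add_le_add hN hF)
  rw [← ofReal_norm] at h2
  exact (ENNReal.ofReal_le_ofReal_iff (mul_nonneg (by positivity) (add_nonneg ha hb))).1 h2

/-- **The axisymmetric Biot–Savart sup bound with an explicit constant** (Feng–Šverák /
Gallay–Šverák (2.14), three-dimensional form): for a continuous integrable vector field `w` on
`ℝ³` whose norm is invariant under the rotations about the axis (`‖w(R_θ y)‖ = ‖w(y)‖`, e.g.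
`w` axisymmetric) and satisfies `‖w(y)‖ ≤ M r(y)`, the Biot–Savart velocity obeys
`‖(K₃ ∗ w)(x)‖ ≤ 3 √(M ∫‖w‖)` for every `x`. In the units of Gallay–Šverák
(`∫_{ℝ³}‖ω‖ = 2π‖rω_θ‖_{L¹(Ω)}`, `M = ‖ω_θ/r‖_{L^∞}`):
`‖u‖_{L^∞} ≤ 3√(2π) ‖rω_θ‖_{L¹(Ω)}^{1/2}‖ω_θ/r‖_{L^∞}^{1/2}`. Proof: with `A = ∫‖w‖`,
`s = √(A/M)`, take `ρ = √s` if `r(x) ≤ √s` (`norm_biotSavart_le_of_scale`: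
`≤ (2 + 1/(4π))√(AM)`) and `ρ = s/(2r(x))` otherwise
(`norm_biotSavart_le_of_two_mul_le_cylRadius`: `≤ (3/4 + 5/π²)√(AM)`).
[cite: GallaySverak2016, Prop. 2.6 (2.14) (arXiv p. 8)] -/
theorem norm_biotSavart_le_sqrt_of_norm_le_mul_cylRadius (hwc : Continuous w) (hwi : Integrable w)
    (hw : ∀ θ y, ‖w (rotZ θ y)‖ = ‖w y‖) (hwM : ∀ y, ‖w y‖ ≤ M * cylRadius y)
    (x : EuclideanSpace ℝ (Fin 3)) :
    ‖biotSavart w x‖ ≤ 3 * Real.sqrt ((∫ y, ‖w y‖) * M) := by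
  set A : ℝ := ∫ y, ‖w y‖ with hAdef
  have hA0 : 0 ≤ A := integral_nonneg fun _ => norm_nonneg _
  have hπ := Real.pi_pos
  have hπ3 := Real.pi_gt_three
  by_cases hw0 : ∀ y, w y = 0
  · have : w = 0 := funext hw0
    rw [this, biotSavart_zero, Pi.zero_apply, norm_zero]
    positivity
  obtain ⟨y₀, hy₀⟩ := not_forall.1 hw0
  have hMpos : 0 < M := by
    by_contra hle
    have h1 := hwM y₀
    have h2 : 0 < ‖w y₀‖ := norm_pos_iff.2 hy₀
    nlinarith [cylRadius_nonneg y₀, not_lt.1 hle]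
  have hApos : 0 < A := by
    rw [hAdef, integral_pos_iff_support_of_nonneg (fun _ => norm_nonneg _) hwi.norm]
    refine (hwc.norm.isOpen_support).measure_pos volume ⟨y₀, ?_⟩
    rw [mem_support]; exact (norm_pos_iff.2 hy₀).ne'
  set t : ℝ := Real.sqrt (A * M) with htdef
  have ht : 0 < t := Real.sqrt_pos.2 (by positivity)
  have ht2 : t ^ 2 = A * M := Real.sq_sqrt (by positivity)
  set s : ℝ := t / M with hsdef
  have hs : 0 < s := div_pos ht hMpos
  have e1 : M * s = t := by rw [hsdef]; field_simp
  have e2 : A / s = t := by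
    rw [hsdef, div_div_eq_mul_div, div_eq_iff ht.ne']
    linear_combination ht2.symm
  set r : ℝ := cylRadius x with hrdef
  have hr0 : 0 ≤ r := cylRadius_nonneg x
  by_cases hcase : r ^ 2 ≤ s
  · -- near the axis: `ρ = √s`
    set ρ : ℝ := Real.sqrt s with hρdef
    have hρ : 0 < ρ := Real.sqrt_pos.2 hs
    have hρ2 : ρ ^ 2 = s := Real.sq_sqrt hs.le
    have hrρ : r ≤ ρ := by
      rw [hρdef, ← Real.sqrt_sq hr0]
      exact Real.sqrt_le_sqrt hcase
    have hb := norm_biotSavart_le_of_scale hwc hwi hMpos.le hwM x hρ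
    have hb1 : M * (r + ρ) * (4 * π * ρ) ≤ 8 * π * t := by
      calc M * (r + ρ) * (4 * π * ρ) ≤ M * (ρ + ρ) * (4 * π * ρ) := by gcongr
        _ = 8 * π * (M * ρ ^ 2) := by ring
        _ = 8 * π * t := by rw [hρ2, e1]
    have hb2 : (ρ ^ 2)⁻¹ * A = t := by rw [hρ2, inv_mul_eq_div, e2]
    calc ‖biotSavart w x‖ ≤ (4 * π)⁻¹ * (M * (r + ρ) * (4 * π * ρ) + (ρ ^ 2)⁻¹ * A) := hb
      _ ≤ (4 * π)⁻¹ * (8 * π * t + t) := by rw [hb2]; gcongr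
      _ = 2 * t + t / (4 * π) := by field_simp; ring
      _ ≤ 3 * t := by
          have : t / (4 * π) ≤ t := by
            rw [div_le_iff₀ (by positivity)]; nlinarith
          linarith
  · -- far from the axis: `ρ = s/(2r)`
    rw [not_le] at hcase
    have hrpos : 0 < r := by
      rcases hr0.eq_or_lt with h | h
      · rw [← h] at hcase; nlinarith
      · exact h
    set ρ : ℝ := s / (2 * r) with hρdef
    have hρ : 0 < ρ := by positivity
    have hrρ : 2 * ρ ≤ r := by
      rw [hρdef, mul_div_assoc', div_le_iff₀ (by positivity : (0:ℝ) < 2 * r)]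
      nlinarith
    have hb := norm_biotSavart_le_of_two_mul_le_cylRadius hwc hwi hw hMpos.le hwM x hρ hrρ
    have hb1 : M * (r + ρ) * (4 * π * ρ) ≤ 3 * π * t := by
      have hρr : ρ ≤ r / 2 := by linarith
      calc M * (r + ρ) * (4 * π * ρ) ≤ M * (r + r / 2) * (4 * π * ρ) := by gcongr
        _ = 3 * π * (M * s) := by rw [hρdef]; field_simp; ring
        _ = 3 * π * t := by rw [e1]
    have hb2 : 10 / (π * ρ * r) * A = 20 / π * t := by
      rw [hρdef, ← e2]; field_simp; ring
    calc ‖biotSavart w x‖ ≤ (4 * π)⁻¹ * (M * (r + ρ) * (4 * π * ρ) + 10 / (π * ρ * r) * A) := hb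
      _ ≤ (4 * π)⁻¹ * (3 * π * t + 20 / π * t) := by rw [hb2]; gcongr
      _ = 3 / 4 * t + 5 / π ^ 2 * t := by field_simp; ring
      _ ≤ 3 * t := by
          have : 5 / π ^ 2 * t ≤ t := by
            rw [div_mul_eq_mul_div, div_le_iff₀ (by positivity)]
            have h9 : 9 * t ≤ π ^ 2 * t :=
              mul_le_mul_of_nonneg_right (by nlinarith) ht.le
            linarith
          linarith

/-- **Gallay–Šverák 2015, Proposition 2.6 (2.14) — discharged** (`C = 3`): the named fact
`GallaySverak2015.VelocitySupBound` holds. For an axisymmetric `w` the norm is rotation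
invariant (`‖w(R_θ y)‖ = ‖R_θ w(y)‖ = ‖w(y)‖`), so
`norm_biotSavart_le_sqrt_of_norm_le_mul_cylRadius` applies (the toroidality hypotheses of the
fact are not needed for the bound). [cite: GallaySverak2016, Prop. 2.6 (2.14) (arXiv p. 8)] -/
theorem GallaySverak2015.VelocitySupBound_holds : GallaySverak2015.VelocitySupBound :=
  ⟨3, by norm_num, fun w _M hwc hwi hax _ _ hwM x =>
    norm_biotSavart_le_sqrt_of_norm_le_mul_cylRadius hwc hwi
      (fun θ y => by rw [hax θ y, norm_rotZ]) hwM x⟩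

end Assembly

/-! ### The sup-norm form `‖u‖_∞ ≤ C ‖ω_θ‖_{L¹(Ω)}^{1/2} ‖ω_θ‖_{L^∞(Ω)}^{1/2}` (Prop. 2.3 (ii), (2.10)) -/

section SupNormForm

/-- **The orbit integral of the far kernel, source far from the axis**: for `r(y) ≥ 2ρ > 0` and
every `x`, `∫_{−π}^{π} 1_{|x − R_φ y| ≥ ρ} |x − R_φ y|⁻² dφ ≤ 20/(ρ r(y))` — the bound of
`lintegral_orbit_far_kernel_le` with the roles of `x` and `y` exchanged, the squared distance
`q(ψ) = (r − r')² + h² + 2rr'(1 − cos ψ)` along the orbit being symmetric in `r = r(x)`,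
`r' = r(y)`. [folklore] -/
private theorem lintegral_orbit_far_kernel_le_source (x y : EuclideanSpace ℝ (Fin 3)) {ρ : ℝ}
    (hρ : 0 < ρ) (hrρ : 2 * ρ ≤ cylRadius y) :
    ∫⁻ φ in Ioc (-π) π, ENNReal.ofReal ((Ici ρ).indicator (fun s : ℝ => (s ^ 2)⁻¹) ‖x - rotZ φ y‖) ≤
      ENNReal.ofReal (20 / (ρ * cylRadius y)) := by
  set r := cylRadius x with hr
  set r' := cylRadius y with hr'
  set h := x 2 - y 2 with hh
  set c := Complex.arg ⟨y 0, y 1⟩ - Complex.arg ⟨x 0, x 1⟩ with hc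
  set f : ℝ → ℝ := fun ψ => (Ici (ρ ^ 2)).indicator (fun q : ℝ => q⁻¹)
    ((r' - r) ^ 2 + h ^ 2 + 2 * r' * r * (1 - Real.cos ψ)) with hf
  have hP : ∀ φ, (Ici ρ).indicator (fun s : ℝ => (s ^ 2)⁻¹) ‖x - rotZ φ y‖ = f (φ + c) := by
    intro φ
    rw [far_kernel_rotZ_eq x y hρ φ, hf]
    simp only [hr, hr', hh, hc]
    ring_nf
  simp_rw [hP]
  -- properties of `f`
  have hq0 : ∀ ψ, 0 ≤ (r' - r) ^ 2 + h ^ 2 + 2 * r' * r * (1 - Real.cos ψ) := fun ψ => by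
    nlinarith [Real.cos_le_one ψ, sq_nonneg h, sq_nonneg (r' - r),
      mul_nonneg (cylRadius_nonneg y) (cylRadius_nonneg x)]
  have hf0 : ∀ ψ, 0 ≤ f ψ := fun ψ => by
    simp only [hf, indicator, mem_Ici]
    split_ifs
    · exact inv_nonneg.2 (hq0 ψ)
    · exact le_rfl
  have hfρ : ∀ ψ, f ψ ≤ (ρ ^ 2)⁻¹ := fun ψ => by
    simp only [hf, indicator, mem_Ici]
    split_ifs with hψ
    · exact inv_anti₀ (by positivity) hψ
    · positivity
  have hfm : Measurable f := by
    refine (measurable_inv.indicator measurableSet_Ici).comp ?_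
    exact (continuous_const.add (continuous_const.mul
      (continuous_const.sub Real.continuous_cos))).measurable
  have hper : Function.Periodic f (2 * π) := fun ψ => by
    simp only [hf, Real.cos_add_two_pi]
  have hmeas : Measurable (fun φ => f (φ + c)) := hfm.comp (measurable_id.add_const c)
  have hfi : IntegrableOn (fun φ => f (φ + c)) (Ioc (-π) π) :=
    (intervalIntegrable_of_bounded (B := (ρ ^ 2)⁻¹) hmeas
      (fun φ => by rw [abs_of_nonneg (hf0 _)]; exact hfρ _) (-π) π).1
  rw [← ofReal_integral_eq_lintegral_ofReal hfi (Eventually.of_forall fun φ => hf0 _)]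
  refine ENNReal.ofReal_le_ofReal ?_
  have hππ : -π ≤ π := by linarith [Real.pi_pos]
  rw [← intervalIntegral.integral_of_le hππ, intervalIntegral.integral_comp_add_right f c,
    show π + c = -π + c + 2 * π by ring, hper.intervalIntegral_add_eq (-π + c) (-π),
    show -π + 2 * π = π by ring]
  exact intervalIntegral_far_kernel_le (cylRadius_nonneg x) hρ hrρ

/-- **The orbit integral of the far kernel, weighted by the source radius**: for every `x`, `y`
and `ρ > 0`, `r(y) ∫_{−π}^{π} 1_{|x − R_φ y| ≥ ρ} |x − R_φ y|⁻² dφ ≤ 20/ρ` (for `r(y) ≥ 2ρ` by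
`lintegral_orbit_far_kernel_le_source`; for `r(y) < 2ρ` by the trivial bound `2π/ρ²` of the
orbit integral, `4π ≤ 20`). [folklore] -/
private theorem lintegral_orbit_far_kernel_mul_cylRadius_le (x y : EuclideanSpace ℝ (Fin 3))
    {ρ : ℝ} (hρ : 0 < ρ) :
    ∫⁻ φ in Ioc (-π) π, ENNReal.ofReal (cylRadius (rotZ φ y) *
        (Ici ρ).indicator (fun s : ℝ => (s ^ 2)⁻¹) ‖x - rotZ φ y‖) ≤ ENNReal.ofReal (20 / ρ) := by
  have hπ := Real.pi_pos
  simp_rw [cylRadius_rotZ, ENNReal.ofReal_mul (cylRadius_nonneg y)]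
  have hKm : Measurable fun φ : ℝ =>
      ENNReal.ofReal ((Ici ρ).indicator (fun s : ℝ => (s ^ 2)⁻¹) ‖x - rotZ φ y‖) := by
    have he : Measurable ((Ici ρ).indicator fun s : ℝ => (s ^ 2)⁻¹) :=
      ((measurable_id.pow_const 2).inv).indicator measurableSet_Ici
    have hm0 : Measurable fun φ : ℝ => rotZ φ y :=
      (continuous_rotZ_prod''.comp (continuous_id.prodMk continuous_const)).measurable
    exact (he.comp (measurable_const.sub hm0).norm).ennreal_ofReal
  rw [lintegral_const_mul _ hKm]
  by_cases hcase : 2 * ρ ≤ cylRadius y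
  · have hr : 0 < cylRadius y := by linarith
    calc ENNReal.ofReal (cylRadius y) *
          ∫⁻ φ in Ioc (-π) π, ENNReal.ofReal ((Ici ρ).indicator (fun s : ℝ => (s ^ 2)⁻¹) ‖x - rotZ φ y‖)
        ≤ ENNReal.ofReal (cylRadius y) * ENNReal.ofReal (20 / (ρ * cylRadius y)) :=
          mul_le_mul' le_rfl (lintegral_orbit_far_kernel_le_source x y hρ hcase)
      _ = ENNReal.ofReal (20 / ρ) := by
          rw [← ENNReal.ofReal_mul (cylRadius_nonneg y)]
          congr 1
          field_simp
  · rw [not_le] at hcase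
    have hvol : volume (Ioc (-π) π) = ENNReal.ofReal (2 * π) := by
      rw [Real.volume_Ioc]; congr 1; ring
    have hKρ : ∀ φ, (Ici ρ).indicator (fun s : ℝ => (s ^ 2)⁻¹) ‖x - rotZ φ y‖ ≤ (ρ ^ 2)⁻¹ :=
      fun φ => by
        simp only [indicator, mem_Ici]
        split_ifs with h
        · exact inv_anti₀ (by positivity) (pow_le_pow_left₀ hρ.le h 2)
        · positivity
    have h1 : ∫⁻ φ in Ioc (-π) π,
        ENNReal.ofReal ((Ici ρ).indicator (fun s : ℝ => (s ^ 2)⁻¹) ‖x - rotZ φ y‖) ≤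
          ENNReal.ofReal ((ρ ^ 2)⁻¹) * ENNReal.ofReal (2 * π) := by
      calc ∫⁻ φ in Ioc (-π) π,
            ENNReal.ofReal ((Ici ρ).indicator (fun s : ℝ => (s ^ 2)⁻¹) ‖x - rotZ φ y‖)
          ≤ ∫⁻ _ in Ioc (-π) π, ENNReal.ofReal ((ρ ^ 2)⁻¹) :=
            lintegral_mono fun φ => ENNReal.ofReal_le_ofReal (hKρ φ)
        _ = ENNReal.ofReal ((ρ ^ 2)⁻¹) * ENNReal.ofReal (2 * π) := by
            rw [setLIntegral_const, hvol]
    calc ENNReal.ofReal (cylRadius y) *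
          ∫⁻ φ in Ioc (-π) π, ENNReal.ofReal ((Ici ρ).indicator (fun s : ℝ => (s ^ 2)⁻¹) ‖x - rotZ φ y‖)
        ≤ ENNReal.ofReal (cylRadius y) * (ENNReal.ofReal ((ρ ^ 2)⁻¹) * ENNReal.ofReal (2 * π)) :=
          mul_le_mul' le_rfl h1
      _ = ENNReal.ofReal (cylRadius y * ((ρ ^ 2)⁻¹ * (2 * π))) := by
          rw [← ENNReal.ofReal_mul (by positivity), ← ENNReal.ofReal_mul (cylRadius_nonneg y)]
      _ ≤ ENNReal.ofReal (20 / ρ) := by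
          refine ENNReal.ofReal_le_ofReal ?_
          have hπ4 := Real.pi_lt_d2
          calc cylRadius y * ((ρ ^ 2)⁻¹ * (2 * π)) ≤ 2 * ρ * ((ρ ^ 2)⁻¹ * (2 * π)) :=
                mul_le_mul_of_nonneg_right hcase.le (by positivity)
            _ = 4 * π / ρ := by field_simp; ring
            _ ≤ 20 / ρ := div_le_div_of_nonneg_right (by linarith) hρ.le

/-- **The far-field bound, source-weighted.** For continuous `w` with rotation-invariant norm,
every `x` and every `ρ > 0`:
`∫ ‖w(y)‖ 1_{|x−y| ≥ ρ} |x − y|⁻² dy ≤ (10/(πρ)) ∫ ‖w(y)‖/r(y) dy` — rotation averaging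
(`ofReal_two_pi_mul_lintegral_mul_le`) of the rotation-invariant weight `‖w‖/r` against the
kernel `r(y) 1_{|x−y| ≥ ρ}|x − y|⁻²`, whose orbit integrals are `≤ 20/ρ`; the two integrands agree
off the axis, a null set (`volume_axis_eq_zero`). [folklore] -/
private theorem lintegral_enorm_mul_far_kernel_le_source
    {w : EuclideanSpace ℝ (Fin 3) → EuclideanSpace ℝ (Fin 3)} (hwc : Continuous w)
    (hw : ∀ θ y, ‖w (rotZ θ y)‖ = ‖w y‖) (x : EuclideanSpace ℝ (Fin 3)) {ρ : ℝ} (hρ : 0 < ρ) :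
    ∫⁻ y, ‖w y‖ₑ * ENNReal.ofReal ((Ici ρ).indicator (fun s : ℝ => (s ^ 2)⁻¹) ‖x - y‖) ≤
      ENNReal.ofReal (10 / (π * ρ)) * ∫⁻ y, ENNReal.ofReal (‖w y‖ / cylRadius y) := by
  have hπ := Real.pi_pos
  set a : EuclideanSpace ℝ (Fin 3) → ℝ≥0∞ := fun y => ENNReal.ofReal (‖w y‖ / cylRadius y)
    with ha_def
  set G : EuclideanSpace ℝ (Fin 3) → ℝ≥0∞ := fun y => ENNReal.ofReal (cylRadius y *
    (Ici ρ).indicator (fun s : ℝ => (s ^ 2)⁻¹) ‖x - y‖) with hG_def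
  have ha : ∀ θ y, a (rotZ θ y) = a y := fun θ y => by
    simp only [ha_def, hw, cylRadius_rotZ]
  have ham : Measurable a :=
    (hwc.norm.measurable.div continuous_cylRadius.measurable).ennreal_ofReal
  have he : Measurable ((Ici ρ).indicator fun s : ℝ => (s ^ 2)⁻¹) :=
    ((measurable_id.pow_const 2).inv).indicator measurableSet_Ici
  have hGm : Measurable G :=
    (continuous_cylRadius.measurable.mul
      (he.comp (measurable_const.sub measurable_id).norm)).ennreal_ofReal
  have hB : ∀ y, ∫⁻ φ in Ioc (-π) π, G (rotZ φ y) ≤ ENNReal.ofReal (20 / ρ) := fun y =>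
    lintegral_orbit_far_kernel_mul_cylRadius_le x y hρ
  have key := ofReal_two_pi_mul_lintegral_mul_le ha ham hGm hB
  -- the two integrands agree off the axis
  have hae : (fun y => ‖w y‖ₑ * ENNReal.ofReal ((Ici ρ).indicator (fun s : ℝ => (s ^ 2)⁻¹) ‖x - y‖))
      =ᵐ[volume] fun y => a y * G y := by
    have hax : ∀ᵐ y : EuclideanSpace ℝ (Fin 3), y 0 ^ 2 + y 1 ^ 2 ≠ 0 := by
      rw [ae_iff]
      simpa using volume_axis_eq_zero
    filter_upwards [hax] with y hy
    have hr : cylRadius y ≠ 0 := by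
      intro h0
      apply hy
      rw [← cylRadius_sq, h0]
      ring
    simp only [ha_def, hG_def]
    rw [← ENNReal.ofReal_mul (div_nonneg (norm_nonneg _) (cylRadius_nonneg _)), ← ofReal_norm,
      ← ENNReal.ofReal_mul (norm_nonneg _)]
    congr 1
    field_simp
  rw [lintegral_congr_ae hae]
  have e : ENNReal.ofReal (20 / ρ) =
      ENNReal.ofReal (2 * π) * ENNReal.ofReal (10 / (π * ρ)) := by
    rw [← ENNReal.ofReal_mul (by positivity)]
    congr 1
    field_simp
    ring
  rw [e, mul_assoc] at key
  exact (ENNReal.mul_le_mul_iff_right (ENNReal.ofReal_pos.2 (by positivity)).ne'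
    ENNReal.ofReal_ne_top).1 key

/-- **The near-field bound under a sup bound**: if `‖w(y)‖ ≤ L` (`L ≥ 0`) then
`∫ ‖w(y)‖ 1_{|x−y|<ρ} |x−y|⁻² dy ≤ L · 4πρ` (`∫_{|z|<ρ}|z|⁻² = 4πρ`). [folklore] -/
private theorem lintegral_enorm_mul_kernelMajorant_le_of_norm_le
    {w : EuclideanSpace ℝ (Fin 3) → EuclideanSpace ℝ (Fin 3)} {L : ℝ} (hL : 0 ≤ L)
    (hwL : ∀ y, ‖w y‖ ≤ L) (x : EuclideanSpace ℝ (Fin 3)) {ρ : ℝ} (hρ : 0 < ρ) :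
    ∫⁻ y, ‖w y‖ₑ * ENNReal.ofReal (kernelMajorant ρ (x - y)) ≤
      ENNReal.ofReal (L * (4 * π * ρ)) := by
  have hpt : ∀ y, ‖w y‖ₑ * ENNReal.ofReal (kernelMajorant ρ (x - y)) ≤
      ENNReal.ofReal L * ENNReal.ofReal (kernelMajorant ρ (x - y)) := fun y => by
    rw [← ofReal_norm]
    exact mul_le_mul' (ENNReal.ofReal_le_ofReal (hwL y)) le_rfl
  have hmk : Measurable fun y : EuclideanSpace ℝ (Fin 3) =>
      ENNReal.ofReal (kernelMajorant ρ (x - y)) :=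
    ((measurable_kernelMajorant ρ).comp (measurable_const.sub measurable_id)).ennreal_ofReal
  calc ∫⁻ y, ‖w y‖ₑ * ENNReal.ofReal (kernelMajorant ρ (x - y))
      ≤ ∫⁻ y, ENNReal.ofReal L * ENNReal.ofReal (kernelMajorant ρ (x - y)) := lintegral_mono hpt
    _ = ENNReal.ofReal L * ENNReal.ofReal (4 * π * ρ) := by
        rw [lintegral_const_mul _ hmk, lintegral_sub_left_eq_self
          (μ := (volume : Measure (EuclideanSpace ℝ (Fin 3))))
          (fun z => ENNReal.ofReal (kernelMajorant ρ z)) x, lintegral_kernelMajorant hρ.le]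
    _ = ENNReal.ofReal (L * (4 * π * ρ)) := (ENNReal.ofReal_mul hL).symm

variable {w : EuclideanSpace ℝ (Fin 3) → EuclideanSpace ℝ (Fin 3)} {L : ℝ}

/-- **Sup bound at scale `ρ`, sup-norm form**: for continuous `w` with rotation-invariant norm,
`‖w‖ ≤ L`, `‖w‖/r ∈ L¹(ℝ³)` and every `ρ > 0`,
`‖(K₃ ∗ w)(x)‖ ≤ (4π)⁻¹ (L · 4πρ + (10/(πρ)) ∫‖w‖/r)`. [folklore] -/
private theorem norm_biotSavart_le_of_scale_of_norm_le (hwc : Continuous w)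
    (hw : ∀ θ y, ‖w (rotZ θ y)‖ = ‖w y‖) (hL : 0 ≤ L) (hwL : ∀ y, ‖w y‖ ≤ L)
    (hwi : Integrable fun y => ‖w y‖ / cylRadius y) (x : EuclideanSpace ℝ (Fin 3)) {ρ : ℝ}
    (hρ : 0 < ρ) :
    ‖biotSavart w x‖ ≤ (4 * π)⁻¹ * (L * (4 * π * ρ) +
      10 / (π * ρ) * ∫ y, ‖w y‖ / cylRadius y) := by
  have hπ := Real.pi_pos
  have hA0 : 0 ≤ ∫ y, ‖w y‖ / cylRadius y :=
    integral_nonneg fun y => div_nonneg (norm_nonneg _) (cylRadius_nonneg _)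
  have hA : ∫⁻ y, ENNReal.ofReal (‖w y‖ / cylRadius y) = ENNReal.ofReal (∫ y, ‖w y‖ / cylRadius y) :=
    (ofReal_integral_eq_lintegral_ofReal hwi
      (Eventually.of_forall fun y => div_nonneg (norm_nonneg _) (cylRadius_nonneg _))).symm
  have hwm : Measurable fun y => ‖w y‖ₑ := hwc.measurable.enorm
  have ha : 0 ≤ L * (4 * π * ρ) := by positivity
  have hb : 0 ≤ 10 / (π * ρ) * ∫ y, ‖w y‖ / cylRadius y := mul_nonneg (by positivity) hA0
  have hN := lintegral_enorm_mul_kernelMajorant_le_of_norm_le hL hwL x hρ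
  have hF := lintegral_enorm_mul_far_kernel_le_source hwc hw x hρ
  rw [hA, ← ENNReal.ofReal_mul (by positivity)] at hF
  have h2 : ‖biotSavart w x‖ₑ ≤ ENNReal.ofReal ((4 * π)⁻¹ * (L * (4 * π * ρ) +
      10 / (π * ρ) * ∫ y, ‖w y‖ / cylRadius y)) := by
    refine (enorm_biotSavart_le_near_add_far hwm x ρ).trans ?_
    rw [ENNReal.ofReal_mul (by positivity), ENNReal.ofReal_add ha hb]
    exact mul_le_mul' le_rfl (add_le_add hN hF)
  rw [← ofReal_norm] at h2
  exact (ENNReal.ofReal_le_ofReal_iff (mul_nonneg (by positivity) (add_nonneg ha hb))).1 h2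

/-- Optimisation over the scale: if `v ≤ aρ + b/ρ` for every `ρ > 0` (`a, b ≥ 0`), then
`v ≤ 2√(ab)`. [folklore] -/
private theorem le_two_mul_sqrt_of_forall_scale {v a b : ℝ} (ha : 0 ≤ a) (hb : 0 ≤ b)
    (h : ∀ ρ : ℝ, 0 < ρ → v ≤ a * ρ + b / ρ) : v ≤ 2 * Real.sqrt (a * b) := by
  rcases ha.eq_or_lt with ha' | ha'
  · -- `a = 0`: `v ≤ b/ρ` for all `ρ`, hence `v ≤ 0`
    rw [← ha', zero_mul, Real.sqrt_zero, mul_zero]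
    by_contra hv
    rw [not_le] at hv
    have h1 := h ((b + 1) / v) (by positivity)
    rw [← ha', zero_mul, zero_add, div_div_eq_mul_div, le_div_iff₀ (by positivity)] at h1
    nlinarith
  rcases hb.eq_or_lt with hb' | hb'
  · -- `b = 0`: `v ≤ aρ` for all `ρ`, hence `v ≤ 0`
    rw [← hb', mul_zero, Real.sqrt_zero, mul_zero]
    by_contra hv
    rw [not_le] at hv
    have h1 := h (v / (2 * a)) (by positivity)
    rw [← hb', zero_div, add_zero] at h1
    have e : a * (v / (2 * a)) = v / 2 := by field_simp
    rw [e] at h1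
    linarith
  · -- `a, b > 0`: `ρ = √(b/a)`
    have hs := Real.sqrt_pos.2 (div_pos hb' ha')
    have h1 := h (Real.sqrt (b / a)) hs
    have hsq : Real.sqrt (b / a) * Real.sqrt (b / a) = b / a :=
      Real.mul_self_sqrt (div_pos hb' ha').le
    have e1 : a * Real.sqrt (b / a) = Real.sqrt (a * b) := by
      rw [show a * b = a ^ 2 * (b / a) by field_simp, Real.sqrt_mul (sq_nonneg a),
        Real.sqrt_sq ha'.le]
    have e2 : b / Real.sqrt (b / a) = Real.sqrt (a * b) := by
      rw [div_eq_iff hs.ne', ← e1, mul_assoc, hsq]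
      field_simp
    rw [e1, e2] at h1
    linarith

/-- **The axisymmetric Biot–Savart sup bound in sup-norm form, with an explicit constant**
(Gallay–Šverák 2015, Prop. 2.3 (ii), estimate (2.10) in the case `p = 1`, `q = ∞`:
"`‖u‖_{L^∞(Ω)} ≤ C ‖ω_θ‖_{L^p(Ω)}^σ ‖ω_θ‖_{L^q(Ω)}^{1−σ}`, `σ = (p/2)(q−2)/(q−p)`", here
`σ = 1/2`; three-dimensional form): for a continuous vector field `w` on `ℝ³` whose norm is
invariant under the rotations about the axis (`‖w(R_θ y)‖ = ‖w(y)‖`; every axisymmetric field),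
bounded, `‖w(y)‖ ≤ L`, and with `‖w‖/r ∈ L¹(ℝ³)` (`r = cylRadius`), the Biot–Savart velocity
`K₃ ∗ w = biotSavart w` satisfies, for all `x`,
`‖(K₃ ∗ w)(x)‖ ≤ (11/10) √(L ∫_{ℝ³} ‖w‖/r)`. In the units of the paper (`w = ω_θ e_θ`,
`∫_{ℝ³} ‖ω‖/r dx = 2π ∫_Ω |ω_θ| dr dz = 2π‖ω_θ‖_{L¹(Ω)}`, `L = ‖ω_θ‖_{L^∞(Ω)}`):
`‖u‖_{L^∞} ≤ (11/10)√(2π) ‖ω_θ‖_{L¹(Ω)}^{1/2} ‖ω_θ‖_{L^∞(Ω)}^{1/2}` — the kinematic half of the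
paper's (5.12) `‖u(t)‖_∞ ≤ C‖ω_θ(t)‖_{L¹(Ω)}^{1/2}‖ω_θ(t)‖_{L^∞(Ω)}^{1/2} ≤ C(M)/√t`. Proof (not
the paper's, which uses the kernel bound (2.11)): `‖K₃(x−y)w(y)‖ ≤ (4π)⁻¹‖w(y)‖|x−y|⁻²`; near field
`|x−y| < ρ`: `≤ L · 4πρ`; far field by rotation averaging of the weight `‖w‖/r` against
`r(y) 1_{|x−y|≥ρ}|x−y|⁻²`, whose orbit integrals are `≤ 20/ρ`
(`lintegral_orbit_far_kernel_mul_cylRadius_le`): `≤ (10/(πρ)) ∫‖w‖/r`; so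
`‖(K₃ ∗ w)(x)‖ ≤ Lρ + (5/(2π²)) ρ⁻¹ ∫‖w‖/r` for every `ρ > 0`, and the optimal `ρ` gives the
constant `2√(5/(2π²)) = √10/π ≤ 11/10`. No integrability of `w` itself is needed (`biotSavart w x`
is a Bochner integral, and `‖∫f‖ ≤ ∫⁻‖f‖ₑ` always).
[cite: GallaySverak2016, Prop. 2.3 (ii) (2.10), case p = 1, q = ∞ (arXiv p. 7); used as (5.12) (p. 17)] -/
theorem norm_biotSavart_le_sqrt_of_norm_le (hwc : Continuous w)
    (hw : ∀ θ y, ‖w (rotZ θ y)‖ = ‖w y‖) (hwL : ∀ y, ‖w y‖ ≤ L)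
    (hwi : Integrable fun y => ‖w y‖ / cylRadius y) (x : EuclideanSpace ℝ (Fin 3)) :
    ‖biotSavart w x‖ ≤ 11 / 10 * Real.sqrt (L * ∫ y, ‖w y‖ / cylRadius y) := by
  have hπ := Real.pi_pos
  have hπ3 := Real.pi_gt_three
  set A : ℝ := ∫ y, ‖w y‖ / cylRadius y with hAdef
  have hL : 0 ≤ L := (norm_nonneg _).trans (hwL 0)
  have hA0 : 0 ≤ A := integral_nonneg fun y => div_nonneg (norm_nonneg _) (cylRadius_nonneg _)
  have key : ∀ ρ : ℝ, 0 < ρ → ‖biotSavart w x‖ ≤ L * ρ + (5 / (2 * π ^ 2) * A) / ρ := by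
    intro ρ hρ
    refine (norm_biotSavart_le_of_scale_of_norm_le hwc hw hL hwL hwi x hρ).trans (le_of_eq ?_)
    field_simp
    ring
  have h1 := le_two_mul_sqrt_of_forall_scale hL (by positivity) key
  -- `2√(L (5/(2π²)) A) = √(10/π²) √(LA) ≤ (11/10)√(LA)` since `π² > 9`
  have hX : 0 ≤ L * (5 / (2 * π ^ 2) * A) := by positivity
  have e2 : Real.sqrt (2 ^ 2 * (L * (5 / (2 * π ^ 2) * A))) =
      2 * Real.sqrt (L * (5 / (2 * π ^ 2) * A)) := by
    rw [Real.sqrt_mul (show (0 : ℝ) ≤ 2 ^ 2 by norm_num),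
      Real.sqrt_sq (show (0 : ℝ) ≤ 2 by norm_num)]
  have e3 : Real.sqrt ((11 / 10) ^ 2 * (L * A)) = 11 / 10 * Real.sqrt (L * A) := by
    rw [Real.sqrt_mul (show (0 : ℝ) ≤ (11 / 10) ^ 2 by norm_num),
      Real.sqrt_sq (show (0 : ℝ) ≤ 11 / 10 by norm_num)]
  rw [← e2] at h1
  rw [← e3]
  refine h1.trans (Real.sqrt_le_sqrt ?_)
  have hπ2 : 9 ≤ π ^ 2 := by nlinarith
  have hq : 10 / π ^ 2 ≤ 10 / 9 := div_le_div_of_nonneg_left (by norm_num) (by norm_num) hπ2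
  have e4 : 2 ^ 2 * (L * (5 / (2 * π ^ 2) * A)) = 10 / π ^ 2 * (L * A) := by
    field_simp
    ring
  rw [e4]
  have hLA : 0 ≤ L * A := mul_nonneg hL hA0
  nlinarith [mul_le_mul_of_nonneg_right hq hLA]

/-- **Gallay–Šverák 2015, Prop. 2.3 (ii) (2.10), `p = 1`, `q = ∞` — for axisymmetric fields**
(`IsAxisymmetric w`: `w(R_θ y) = R_θ w(y)`, so `‖w(R_θ y)‖ = ‖w(y)‖`): for `w` continuous,
axisymmetric, `‖w‖ ≤ L`, `‖w‖/r ∈ L¹(ℝ³)`: `‖(K₃ ∗ w)(x)‖ ≤ (11/10)√(L ∫‖w‖/r)` for all `x`. For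
the vorticity `w = curl u` of an axisymmetric swirl-free `u`, `‖w‖/r = |ω_θ/r| = |angVortQuot u|`
(`norm_curl_eq_cylRadius_mul_abs_angVortQuot`), so `∫‖w‖/r = ∫|η|` is Gallay–Šverák's
`2π‖ω_θ‖_{L¹(Ω)}`, non-increasing along swirl-free axisymmetric Navier–Stokes flows (Lemma 5.1,
`IsTaoSolutionOn.lintegral_abs_angVortQuot_le_of_datum`).
[cite: GallaySverak2016, Prop. 2.3 (ii) (2.10), case p = 1, q = ∞ (arXiv p. 7)] -/
theorem norm_biotSavart_le_sqrt_of_isAxisymmetric_of_norm_le (hwc : Continuous w)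
    (hax : IsAxisymmetric w) (hwL : ∀ y, ‖w y‖ ≤ L)
    (hwi : Integrable fun y => ‖w y‖ / cylRadius y) (x : EuclideanSpace ℝ (Fin 3)) :
    ‖biotSavart w x‖ ≤ 11 / 10 * Real.sqrt (L * ∫ y, ‖w y‖ / cylRadius y) :=
  norm_biotSavart_le_sqrt_of_norm_le hwc (fun θ y => by rw [hax θ y, norm_rotZ]) hwL hwi x

end SupNormForm

end Literature.Analysis.FluidPDE

end
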